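import Literature.NumberTheory.Automorphic.Liu2021.Def411WeilCarriersAtLineClassTransportPU
import Literature.NumberTheory.Automorphic.Liu2021.Def411WeilCarriersAtLineReindex
import HarnessLib

/-!
# [Liu2021, Def. 4.11]: the line-class transport of `ω(μ, ε, χ)` — EVERY RANK, EVERY ENUMERATION (the master
# `lineClassTransport_equiv` of the Hodge-CM floor-0 programmes P4 (stub S4a) and P2 (socket (C′)))

Topic `NumberTheory/Automorphic/Liu2021`; namespace `Literature.NumberTheory.Automorphic.Liu2021.Def411WeilCarriers` (sequel of ★
`Def411WeilCarriersAtLineClassTransportPU` ED. 2 and ★ `Def411WeilCarriersAtLineReindex`).  ONE THEOREM; nothing of [Liu2021] is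
asserted.  Cell hodgecm-mathlib, crux H413 (stmt-HodgeConjecture-24833).

* **`lineClassTransport_equiv`** — for a CM field `L`, ANY rank `N′`, ANY enumeration `e₁ : Fin N′ × Fin 1 ≃ Fin n′` of `V ⊗ W`, a
  real non-zero diagonal frame `dV`, a unitary splitting character `χ_V`, `χ ∈ Chi`, and lines `a, a′ ∈ (L⁺)ˣ` with
  `locF L⁺ δ² a = locF L⁺ δ² a′`: `∃ Ψ : omegaAtLine … e₁ … a χ ≃ₗ[ℂ] omegaAtLine … e₁ … a′ χ` intertwining `rhoVAtLine` ON THE NOSE.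
  = the enumeration independence ★ `Def411WeilCarriersDoubling.exists_omegaAtLine_equiv_rhoVAtLine_reindex` (F0P4-p04) at the
  lines `a`, `a′` (frames `e₁ ↔ Equiv.prodUnique (Fin N′) (Fin 1)`) around the every-rank master ★
  `exists_omegaAtLine_equiv_rhoVAtLine_of_locF_eq'` at `Equiv.prodUnique`.  Its statement is, binder for binder, the hypothesis
  `hLT` of P2's ★ `Theorems/H413LineClassTransportOfEquiv.lean :: rhoAtLine_lineClassTransport_of_equiv`, so that
  `rhoAtLine_lineClassTransport_holds := rhoAtLine_lineClassTransport_of_equiv lineClassTransport_equiv`; P4's stub S4a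
  `StubT3aLineTransportAt` (`N′ = 3`, `L : CorCM.CMField`, family `OmegaChiSplitting.hsChiD` = this family by `δ`) is the instance
  `fun L n e dV … h => lineClassTransport_equiv L e dV … h`.

HC_CM is proved only modulo the printed citations until rung 0 closes; this file proves nothing printed.

## References
* [Liu2021] Y. Liu, Camb. J. Math. 9 (2021) = arXiv:2102.11518: Def. 4.11 (l. 2092–2096), Def. 4.12, App. D §D.1 Step 1 footnote
  (l. 5215), Steps 2–3 (l. 5217–5221), Lemma D.1 (3) (l. 5233).
* [GelbartRogawski1991] S. Gelbart, J. Rogawski, Invent. Math. 105 (1991), §3.1 Prop. 3.1.1 p. 455, Remark p. 457 L4–13.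
* [MoeglinVignerasWaldspurger1987] C. Mœglin, M.-F. Vignéras, J.-L. Waldspurger, LNM 1291 (1987), Chap. 2 II.1, Chap. 3 I.1–I.3.
* [Flath1979] D. Flath, PSPM 33 (1979) part 1, §2 Example 2.
-/

set_option autoImplicit false

noncomputable section

open scoped Matrix
open NumberField
open Literature.NumberTheory.Automorphic Literature.NumberTheory.Automorphic.UnitaryGroup

namespace Literature.NumberTheory.Automorphic.Liu2021.Def411WeilCarriers

open Literature.NumberTheory.GelbartRogawski1991 Literature.NumberTheory.GelbartRogawski1991.UnitaryDualPair
open Literature.NumberTheory.Automorphic.Liu2021.Def411WeilCarriersDoubling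
open Literature.NumberTheory.GaloisRepresentations (HeckeCharacter)
open Literature.RepresentationTheory.HarrisKudlaSweet1996

-- heartbeats: the statement spells Liu's carriers at the `χ_V`-splitting families of two lines and two frames (as ★
-- `exists_omegaAtLine_equiv_rhoVAtLine_reindex`); the default budget times out on the `LinearEquiv.trans` chain.
set_option maxHeartbeats 3200000 in
/-- **[Liu2021, Def. 4.11 ∕ App. D §D.1 Step 1 footnote l. 5215] — THE LINE-CLASS TRANSPORT, every rank, every enumeration.**
For `L` CM, a rank `N′`, an enumeration `e₁ : Fin N′ × Fin 1 ≃ Fin n′`, a real non-zero diagonal frame `dV`, a unitary Hecke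
character `χ_V` with the rank-one splitting condition, `χ ∈ Chi`, and lines `a, a′ ∈ (L⁺)ˣ` with the same local norm class at every
finite place, the carriers `ω(μ, ε, χ)` realised at `⟨a⟩` and at `⟨a′⟩` (at the `χ_V`-attached splittings
`isCompatible_chiSplittingLine`) are isomorphic, `U(diag dV)(𝔸_{L⁺,f})`-equivariantly ON THE NOSE:
`∃ Ψ, ∀ k x, Ψ (rhoVAtLine … a χ k x) = rhoVAtLine … a′ χ k (Ψ x)`.  Proof: `Ψ := R_a ∘ Ψ₀ ∘ R_{a′}⁻¹` with `R` the enumeration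
transports `e₁ → Equiv.prodUnique` (★ `exists_omegaAtLine_equiv_rhoVAtLine_reindex`) and `Ψ₀` the every-rank master at
`Equiv.prodUnique` (★ `exists_omegaAtLine_equiv_rhoVAtLine_of_locF_eq'`).
[cite: Liu2021, Def. 4.11 (l. 2092–2096); Def. 4.12; App. D §D.1 Step 1 footnote (l. 5215), Steps 2–3 (l. 5217–5221)]
[cite: GelbartRogawski1991, §3.1 Prop. 3.1.1 p. 455 L1–3; Remark p. 457 L4–13] [cite: MoeglinVignerasWaldspurger1987, Chap. 3 I.1–I.3]
[cite: Flath1979, §2 Example 2] -/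
theorem lineClassTransport_equiv
    (L : Type) [Field L] [NumberField L] [IsCMField L] {N' n' : ℕ} (e₁ : Fin N' × Fin 1 ≃ Fin n')
      (dV : Fin N' → L) (hdV : ∀ i, IsCMField.complexConj L (dV i) = dV i) (hdV0 : ∀ i, dV i ≠ 0)
      (χV : HeckeCharacter L) (hχu : χV.IsUnitary) (hχs : IsSplittingChar L 1 χV)
      (χ : Chi (↥(maximalRealSubfield L)) L (IsCMField.complexConj L)) (a a' : (↥(maximalRealSubfield L))ˣ)
      (hloc : locF (↥(maximalRealSubfield L)) (imagUnitSq L) a = locF (↥(maximalRealSubfield L)) (imagUnitSq L) a') :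
        ∃ Ψ : omegaAtLine (↥(maximalRealSubfield L)) L (IsCMField.complexConj L) N' e₁ (Matrix.diagonal dV)
                (complexConj_imagUnit L) (imagUnit_ne_zero L) (imagUnit_mul_self L) (realDiagonal_isSymm L dV hdV)
                (isUnit_det_realDiagonal L dV hdV hdV0) (realDiagonal_map L dV hdV).symm
                (fun b => isCompatible_chiSplittingLine L e₁ dV hdV hdV0 χV hχu hχs
                  (TW (↥(maximalRealSubfield L)) b) (isSymm_TW (↥(maximalRealSubfield L)) b)
                  (isUnit_det_TW (↥(maximalRealSubfield L)) b) (JW (↥(maximalRealSubfield L)) L b)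
                  (JW_eq (↥(maximalRealSubfield L)) L b))
                a χ ≃ₗ[ℂ]
              omegaAtLine (↥(maximalRealSubfield L)) L (IsCMField.complexConj L) N' e₁ (Matrix.diagonal dV)
                (complexConj_imagUnit L) (imagUnit_ne_zero L) (imagUnit_mul_self L) (realDiagonal_isSymm L dV hdV)
                (isUnit_det_realDiagonal L dV hdV hdV0) (realDiagonal_map L dV hdV).symm
                (fun b => isCompatible_chiSplittingLine L e₁ dV hdV hdV0 χV hχu hχs
                  (TW (↥(maximalRealSubfield L)) b) (isSymm_TW (↥(maximalRealSubfield L)) b)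
                  (isUnit_det_TW (↥(maximalRealSubfield L)) b) (JW (↥(maximalRealSubfield L)) L b)
                  (JW_eq (↥(maximalRealSubfield L)) L b))
                a' χ,
          ∀ (k : finAdelic (↥(maximalRealSubfield L)) L (IsCMField.complexConj L) N' (Matrix.diagonal dV)) x,
            Ψ (rhoVAtLine (↥(maximalRealSubfield L)) L (IsCMField.complexConj L) N' e₁ (Matrix.diagonal dV)
                  (complexConj_imagUnit L) (imagUnit_ne_zero L) (imagUnit_mul_self L) (realDiagonal_isSymm L dV hdV)
                  (isUnit_det_realDiagonal L dV hdV hdV0) (realDiagonal_map L dV hdV).symm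
                  (fun b => isCompatible_chiSplittingLine L e₁ dV hdV hdV0 χV hχu hχs
                    (TW (↥(maximalRealSubfield L)) b) (isSymm_TW (↥(maximalRealSubfield L)) b)
                    (isUnit_det_TW (↥(maximalRealSubfield L)) b) (JW (↥(maximalRealSubfield L)) L b)
                    (JW_eq (↥(maximalRealSubfield L)) L b))
                  a χ k x) =
              rhoVAtLine (↥(maximalRealSubfield L)) L (IsCMField.complexConj L) N' e₁ (Matrix.diagonal dV)
                  (complexConj_imagUnit L) (imagUnit_ne_zero L) (imagUnit_mul_self L) (realDiagonal_isSymm L dV hdV)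
                  (isUnit_det_realDiagonal L dV hdV hdV0) (realDiagonal_map L dV hdV).symm
                  (fun b => isCompatible_chiSplittingLine L e₁ dV hdV hdV0 χV hχu hχs
                    (TW (↥(maximalRealSubfield L)) b) (isSymm_TW (↥(maximalRealSubfield L)) b)
                    (isUnit_det_TW (↥(maximalRealSubfield L)) b) (JW (↥(maximalRealSubfield L)) L b)
                    (JW_eq (↥(maximalRealSubfield L)) L b))
                  a' χ k (Ψ x) := by
  obtain ⟨R₁, -, hR₁⟩ := exists_omegaAtLine_equiv_rhoVAtLine_reindex L e₁ (Equiv.prodUnique (Fin N') (Fin 1)) dV hdV hdV0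
    χV hχu hχs a χ
  obtain ⟨R₂, -, hR₂⟩ := exists_omegaAtLine_equiv_rhoVAtLine_reindex L e₁ (Equiv.prodUnique (Fin N') (Fin 1)) dV hdV hdV0
    χV hχu hχs a' χ
  obtain ⟨Ψ₀, hΨ₀⟩ := exists_omegaAtLine_equiv_rhoVAtLine_of_locF_eq' L dV hdV hdV0 χV hχu hχs χ a a' hloc
  refine ⟨R₁.trans (Ψ₀.trans R₂.symm), fun k x => R₂.injective ?_⟩
  simp only [LinearEquiv.trans_apply, LinearEquiv.apply_symm_apply, hR₁, hΨ₀, hR₂]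

end Literature.NumberTheory.Automorphic.Liu2021.Def411WeilCarriers

end
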